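import Summits.BirchSwinnertonDyer.BirchSwinnertonDyer.Theorems.CyclotomicUntwistGLTwoFpBorelSecondEigenline
import Summits.BirchSwinnertonDyer.BirchSwinnertonDyer.Theorems.CyclotomicUntwistPSIrrIffSurjThree
import HarnessLib

/-!
# LAW L-irr-p (any prime `p`): `E[p]` with a UNIQUE stable line at `p` and `E[p]` irreducible force
# `ρ̄_{E,p}` onto — the Galois-module step over any field and the assembly over `ℚ`

Cell `pub/bsd-wall` (D-0145 line `route-BirchSwinnertonDyer-CyclotomicUntwist`), seat `bsd-line-cycu-p4`
(width seat 4, gen 6). THEOREMS ONLY (no definition, no named fact, no `sorry`); route-free; BSD is not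
proved by this file, no crux and no W-ALL atom is closed by it. Helper `--supports` K1
(stmt-BirchSwinnertonDyer-21580): the `p = 3` instances are LAW L-irr3
(`…ModThreeNonsplitLineImage`, `…PSIrrIffSurjThree`: `Surj W 3 ↔ Irr W 3` on the cyclic wild cell);
this file is the same law at EVERY prime, on the general core `…GLTwoFpBorelSecondEigenline`.

* §1 (any field `K` of characteristic `0`, elliptic `V/K`, prime `p`):
  **`exists_prime_dvd_orderOf_of_unique_stableLine`** — if `E[p] = V[p](K̄)` has a `Γ_K`-stable subgroup
  of order `p` and only ONE, then some `σ ∈ Γ_K` acts on `E[p]` with order divisible by `p`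
  (frame `E[p] ≅ 𝔽_p²`; the line is a common eigenvector; if every `ρ̄(σ)` had order prime to `p` the
  core gives a second common eigenvector, i.e. a second stable line). Reducible NON-split ⟹ wild.
* §2 (`E/ℚ`): **`orderOf_galoisRepTorsion_absGaloisRestrict_prime`**
  (local and global orders of `ρ̄(σ)` agree along `Γ_{ℚ_p} → Γ_ℚ`, tree `torsionTransferEquiv_smul`),
  and **`surj_of_irr_of_unique_local_stableLine`**: for every elliptic `W/ℚ` and prime `p`, if
  `E[p](ℚ̄_p)` has a unique `Γ_{ℚ_p}`-stable subgroup of order `p` and `E[p]` is an irreducible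
  `Γ_ℚ`-module, then `ρ̄_{E,p}` is onto (`p ∣ #image`, Serre Prop. 15 via the tree's
  `not_dvd_card_of_not_hasSurjectiveModNGaloisRep`).
* §3 W-ALL reading at good ordinary `p ≥ 5`: **`not_unique_local_stableLine_of_classX9`** — on the
  residual class X9 (non-CM, good ordinary `p ≥ 5`, `E[p]` irreducible, `ρ̄_p` NOT onto) the local module
  `E[p](ℚ̄_p)` does NOT have a unique stable line: since good ordinary reduction supplies a stable line
  (the kernel of reduction), X9 rows are the `p`-SPLIT ones (Gross: companion form mod `p`) — the
  splitness itself is not asserted here (no local ordinary filtration is imported), only «not unique».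

References: J.-P. Serre, Invent. Math. 15 (1972) §2.4 Prop. 15 [Serre1972]; J. E. Cremona, *Algorithms for
Modular Elliptic Curves* (1997) §3.8 [Cremona1997]; B. H. Gross, Duke Math. J. 61 (1990) (companion
forms, context only).
-/

-- single-conjunct summit: `Summit.BirchSwinnertonDyer.BirchSwinnertonDyer.…` repeats the name by design
set_option linter.dupNamespace false
set_option autoImplicit false

noncomputable section

open scoped Classical

universe u

namespace Summit.BirchSwinnertonDyer.BirchSwinnertonDyer.Theorems.PSIrrSurjThree

open Matrix WeierstrassCurve Field Literature.NumberTheory.EllipticCurves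
  Literature.NumberTheory.EllipticCurves.Rank1Residual Literature.NumberTheory.GaloisRepresentations

/-! ### §1 A unique stable line of `E[p]` forces an element of order divisible by `p` -/

section AnyField

variable {K : Type u} [Field K] (V : WeierstrassCurve K) (p : ℕ) [Fact p.Prime]

omit [Fact p.Prime] in
/-- The line of `Q ∈ E[p]` is `Γ_K`-stable as soon as `σ • Q` is a multiple of `Q` for every `σ`.
[folklore] -/
theorem zmultiples_stable_of_smul_mem {Q : geomTorsion V p}
    (h : ∀ σ : absoluteGaloisGroup K, σ • Q ∈ AddSubgroup.zmultiples Q) (σ : absoluteGaloisGroup K)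
    (R : geomTorsion V p) (hR : R ∈ AddSubgroup.zmultiples Q) : σ • R ∈ AddSubgroup.zmultiples Q := by
  obtain ⟨z, rfl⟩ := AddSubgroup.mem_zmultiples_iff.mp hR
  have hz : σ • (z • Q) = z • (σ • Q) := map_zsmul (DistribSMul.toAddMonoidHom (geomTorsion V p) σ) z Q
  rw [hz]
  exact AddSubgroup.zsmul_mem _ (h σ) z

/-- **A reducible NON-split `E[p]` has elements of order divisible by `p` in its image** (any prime `p`,
any field of characteristic `0`). If `E[p] = V[p](K̄)` has a `Γ_K`-stable subgroup `H` of order `p` and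
every `Γ_K`-stable subgroup of order `p` equals `H`, then `p ∣ ord ρ̄(σ)` for some `σ ∈ Γ_K`.
[cite: Serre1972, §2.4 Prop. 15] -/
theorem exists_prime_dvd_orderOf_of_unique_stableLine [CharZero K] [V.IsElliptic]
    (H : AddSubgroup (geomTorsion V p)) (hH : ∀ σ : absoluteGaloisGroup K, ∀ P ∈ H, σ • P ∈ H)
    (hcard : Nat.card H = p)
    (huniq : ∀ H' : AddSubgroup (geomTorsion V p),
      (∀ σ : absoluteGaloisGroup K, ∀ P ∈ H', σ • P ∈ H') → Nat.card H' = p → H' = H) :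
    ∃ σ : absoluteGaloisGroup K, p ∣ orderOf (galoisRepTorsion V p σ) := by
  have hp : p.Prime := Fact.out
  haveI : NeZero (p : K) := ⟨by exact_mod_cast hp.ne_zero⟩
  letI : Module (ZMod p) (geomTorsion V p) := AddSubgroup.torsionBy.zmodModule
  by_contra hno
  push Not at hno
  obtain ⟨e, Φ, he, -, -⟩ := exists_addEquiv_mulEquiv_addAut_GL2 (geomTorsion V p)
    (Literature.NumberTheory.EllipticCurves.natCard_geomTorsion V p)
  obtain ⟨P₀, hP₀, rfl⟩ := Mazur1978.exists_eq_zmultiples_of_natCard_eq V p hcard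
  set f : absoluteGaloisGroup K →* GL (Fin 2) (ZMod p) := Φ.toMonoidHom.comp (galoisRepTorsion V p) with hf
  have hfapply : ∀ (σ : absoluteGaloisGroup K) (Q : geomTorsion V p),
      (f σ : Matrix (Fin 2) (Fin 2) (ZMod p)) *ᵥ e Q = e (σ • Q) := fun σ Q ↦ (he (galoisRepTorsion V p σ) Q).symm
  have hfp : ∀ σ : absoluteGaloisGroup K, ¬ p ∣ orderOf (f σ) := by
    intro σ h
    rw [hf, MonoidHom.comp_apply, MulEquiv.coe_toMonoidHom, MulEquiv.orderOf_eq] at h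
    exact hno σ h
  -- `v := e P₀` is a common eigenvector
  have hv : e P₀ ≠ 0 := fun h ↦ hP₀ (e.injective (by rw [h, map_zero]))
  have hfv : ∀ σ : absoluteGaloisGroup K, ∃ c : ZMod p,
      (f σ : Matrix (Fin 2) (Fin 2) (ZMod p)) *ᵥ e P₀ = c • e P₀ := by
    intro σ
    obtain ⟨z, hz⟩ := AddSubgroup.mem_zmultiples_iff.mp (hH σ P₀ (AddSubgroup.mem_zmultiples P₀))
    exact ⟨(z : ZMod p), by rw [hfapply, ← hz, map_zsmul, Int.cast_smul_eq_zsmul]⟩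
  -- hence a second common eigenvector `w`, i.e. a second stable line
  obtain ⟨w, hw0, hwv, hfw⟩ := exists_second_common_eigenvector_of_prime f hfp hv hfv
  set Q₀ : geomTorsion V p := e.symm w with hQ₀
  have heQ₀ : e Q₀ = w := e.apply_symm_apply w
  have hQ₀0 : Q₀ ≠ 0 := fun h ↦ hw0 (by rw [← heQ₀, h, map_zero])
  have hQmem : ∀ σ : absoluteGaloisGroup K, σ • Q₀ ∈ AddSubgroup.zmultiples Q₀ := by
    intro σ
    obtain ⟨c, hc⟩ := hfw σ
    rw [← heQ₀, hfapply] at hc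
    have hc' : σ • Q₀ = (c.val : ℕ) • Q₀ := by
      apply e.injective
      rw [map_nsmul, hc]
      conv_lhs => rw [← ZMod.natCast_zmod_val c]
      exact Nat.cast_smul_eq_nsmul _ _ _
    rw [hc', ← natCast_zsmul]
    exact AddSubgroup.zsmul_mem _ (AddSubgroup.mem_zmultiples Q₀) _
  have hstab := zmultiples_stable_of_smul_mem V p hQmem
  have hcard' : Nat.card (AddSubgroup.zmultiples Q₀) = p := by
    rw [Nat.card_zmultiples]
    exact addOrderOf_eq_prime (AddSubgroup.torsionBy.nsmul Q₀) hQ₀0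
  have hEq := huniq _ hstab hcard'
  obtain ⟨z, hz⟩ := AddSubgroup.mem_zmultiples_iff.mp (hEq ▸ AddSubgroup.mem_zmultiples Q₀ :
    Q₀ ∈ AddSubgroup.zmultiples P₀)
  exact hwv (z : ZMod p) (by rw [← heQ₀, ← hz, map_zsmul, Int.cast_smul_eq_zsmul])

end AnyField

/-! ### §2 Over `ℚ`: local to global, and the law -/

section Rat

variable (W : WeierstrassCurve ℚ) [W.IsElliptic] (p : ℕ) [Fact p.Prime]

/-- **Local and global orders agree** at any prime `p`: for `σ ∈ Γ_{ℚ_p}` the order of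
`ρ̄_{E,p}(res σ)` on `E[p](ℚ̄)` equals the order of the local `ρ̄(σ)` on `E[p](ℚ̄_p)`
(equivariant transfer `torsionTransferEquiv`). [folklore] -/
theorem orderOf_galoisRepTorsion_absGaloisRestrict_prime (σ : absoluteGaloisGroup ℚ_[p]) :
    orderOf (galoisRepTorsion W p (absGaloisRestrict ℚ ℚ_[p] σ)) =
      orderOf (galoisRepTorsion (W.baseChange ℚ_[p]) p σ) := by
  have hn : ((p : ℕ) : ℤ) ≠ 0 := by exact_mod_cast (Fact.out : p.Prime).ne_zero
  let t := W.torsionTransferEquiv (E := ℚ_[p]) hn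
  rw [orderOf_eq_orderOf_iff]
  intro n
  rw [← map_pow, ← map_pow, ← map_pow, galoisRepTorsion_eq_one_iff, galoisRepTorsion_eq_one_iff]
  constructor
  · intro h S
    obtain ⟨T, rfl⟩ := t.surjective S
    rw [← W.torsionTransferEquiv_smul hn, h T]
  · intro h T
    apply t.injective
    rw [W.torsionTransferEquiv_smul hn]
    exact h (t T)

/-- **LAW L-irr-p (any prime).** For an elliptic curve `E/ℚ` (any model `W`) and a prime `p`: if the
LOCAL module `E[p](ℚ̄_p)` has a UNIQUE `Γ_{ℚ_p}`-stable subgroup of order `p` (reducible, non-split) and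
`E[p]` is an irreducible `Γ_ℚ`-module, then `ρ̄_{E,p} : Γ_ℚ → Aut E[p]` is onto. (§1 gives `σ ∈ Γ_{ℚ_p}`
with `p ∣ ord ρ̄(σ)`; the order survives restriction to `Γ_ℚ`; an irreducible subgroup of `GL₂(𝔽_p)` of
order divisible by `p` with surjective determinant is everything — Serre Prop. 15, tree
`not_dvd_card_of_not_hasSurjectiveModNGaloisRep`.) [cite: Serre1972, §2.4 Prop. 15] -/
theorem surj_of_irr_of_unique_local_stableLine
    (hloc : ∃ H : AddSubgroup (geomTorsion (W.baseChange ℚ_[p]) p),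
      (∀ σ : absoluteGaloisGroup ℚ_[p], ∀ P ∈ H, σ • P ∈ H) ∧ Nat.card H = p ∧
      ∀ H' : AddSubgroup (geomTorsion (W.baseChange ℚ_[p]) p),
        (∀ σ : absoluteGaloisGroup ℚ_[p], ∀ P ∈ H', σ • P ∈ H') → Nat.card H' = p → H' = H)
    (hirr : Irr W p) : Surj W p := by
  obtain ⟨H, hH, hcard, huniq⟩ := hloc
  obtain ⟨σ, hσ⟩ := exists_prime_dvd_orderOf_of_unique_stableLine (W.baseChange ℚ_[p]) p H hH hcard huniq
  rw [← orderOf_galoisRepTorsion_absGaloisRestrict_prime W p σ] at hσ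
  by_contra hns
  obtain ⟨e, Φ, he, -⟩ := W.exists_frame_galoisRepTorsion_rat p
  refine W.not_dvd_card_of_not_hasSurjectiveModNGaloisRep p Φ e he hirr hns (hσ.trans ?_)
  rw [← MulEquiv.orderOf_eq Φ]
  exact Subgroup.orderOf_dvd_natCard _ (W.apply_galoisRepTorsion_mem_map_range p Φ _)

/-- Contrapositive in census vocabulary: **irreducible, NOT onto at `p` ⟹ `E[p](ℚ̄_p)` has no unique
stable line** (it has none, or at least two). [cite: Serre1972, §2.4 Prop. 15] -/
theorem not_unique_local_stableLine_of_irr_of_not_surj (hirr : Irr W p) (hns : ¬ Surj W p) :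
    ¬ ∃ H : AddSubgroup (geomTorsion (W.baseChange ℚ_[p]) p),
      (∀ σ : absoluteGaloisGroup ℚ_[p], ∀ P ∈ H, σ • P ∈ H) ∧ Nat.card H = p ∧
      ∀ H' : AddSubgroup (geomTorsion (W.baseChange ℚ_[p]) p),
        (∀ σ : absoluteGaloisGroup ℚ_[p], ∀ P ∈ H', σ • P ∈ H') → Nat.card H' = p → H' = H :=
  fun h ↦ hns (surj_of_irr_of_unique_local_stableLine W p h hirr)

/-! ### §3 The W-ALL residual class X9 (good ordinary `p ≥ 5`, irreducible, not onto) -/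

/-- **X9 rows have no unique stable line at `p`.** On class X9 of the rank-`≤ 1` residual census
(non-CM, good ordinary at `p ≥ 5`, `E[p]` irreducible, `ρ̄_{E,p}` not onto) the local module `E[p](ℚ̄_p)`
does NOT have a unique `Γ_{ℚ_p}`-stable line; since the kernel of reduction is a stable line at an
ordinary prime, these are the locally SPLIT curves (that last reading is context, not asserted).
[cite: Serre1972, §1.11 and §2.4 Prop. 15] -/
theorem not_unique_local_stableLine_of_classX9 [W.IsGloballyMinimal] (hX : ClassX9 W p) :
    ¬ ∃ H : AddSubgroup (geomTorsion (W.baseChange ℚ_[p]) p),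
      (∀ σ : absoluteGaloisGroup ℚ_[p], ∀ P ∈ H, σ • P ∈ H) ∧ Nat.card H = p ∧
      ∀ H' : AddSubgroup (geomTorsion (W.baseChange ℚ_[p]) p),
        (∀ σ : absoluteGaloisGroup ℚ_[p], ∀ P ∈ H', σ • P ∈ H') → Nat.card H' = p → H' = H :=
  not_unique_local_stableLine_of_irr_of_not_surj W p hX.2.2.2.1 hX.2.2.2.2.1

end Rat

end Summit.BirchSwinnertonDyer.BirchSwinnertonDyer.Theorems.PSIrrSurjThree

end
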